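import Summits.ValiantsHypothesis.ValiantsHypothesis.Theorems.GrenetZeonDualUnipotentThreeHalvesLongMassSubmoduleCeilings

/-!
# `GrenetZeon.DualUnipotentThreeHalves` (stmt-ValiantsHypothesis-24318), line `slow_core`, stub (c) `SlowCore.LongMassSlowLawInv`:
# THE FIRST DEEP-MODE INSTRUMENT — the one-letter mixed words of a certificate vanish (submodule currency)

The lower-side instruments of (c) so far see only PURE words: a certificate `(W, k)` of `V ≤ M_b(ℂ)` forces `w^{k+1} = 0` on `W` (index
shadow, ✓ `pow_eq_zero_of_window`; crit-7's type-I door / RelMMS).  The «deep mode» of V34 §2 — MIXED words in the base point `A ∈ V` and the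
direction `w ∈ W` — had no instrument.  This file lands the first one.  Write the line as `M = A + s·w`; the coefficient of `s^m` in `M^{m+1}`
is the ONE-LETTER mixed word `Σ_{l ≤ m} w^l · A · w^{m−l}` (the derivative of `X ↦ X^{m+1}` at `w` in the direction `A`):

* `coeff_top_lineMat_pow` — the coefficient of `s^m` in `M^m` is `w^m`;
* ★ `coeff_second_lineMat_pow` — the coefficient of `s^m` in `M^{m+1}` is `Σ_{l ≤ m} w^l A w^{m−l}`;
* ★★★ `oneLetterWord_eq_zero_of_window` — if `(V, W)` has the window property at order `k` (window `n`), then for every `A ∈ V`, `w ∈ W` and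
  every `m` with `k + 1 ≤ m` and `m + 1 ≤ n − 1`:  `Σ_{l ≤ m} w^l · A · w^{m−l} = 0`.

So a certificate direction `w` is not only nilpotent of index `≤ k+1`: the whole base space `V` lies in the kernel of the linearised power maps
`A ↦ Σ w^l A w^{m−l}` (`k+1 ≤ m ≤ n−2`) — a condition coupling `W` to `V` that the enemy hunt (V34 §5) can now test by name.
Honest framing.  An instrument (`--supports stmt-ValiantsHypothesis-24318`), NOT progress on (c): (c) `SlowCore.LongMassSlowLawInv`, S3, the crux
24318, 8062 and `VP ≠ VNP` remain OPEN / NOT proved.  No sorry, no definitions, no named facts.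
-/

-- single-conjunct layout: Sub = Summit, duplicated namespace component intended (the name is mandated)
set_option linter.dupNamespace false
set_option autoImplicit false

noncomputable section

namespace Summit.ValiantsHypothesis.ValiantsHypothesis.Theorems.GrenetZeon.LongMassHomogenise

open MvPolynomial Matrix
open scoped BigOperators

variable {b : ℕ}

/-! ## §1 Coefficient bookkeeping along the line `M = A + s·w` -/

/-- One step of the line power: entry `(i,j)` of `M^{m+1} = M^m · (A·C + s·w·C)`. -/
theorem lineMat_pow_succ_apply (A w : Matrix (Fin b) (Fin b) ℂ) (M : Matrix (Fin b) (Fin b) (MvPolynomial (Fin 1) ℂ))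
    (hM : M = A.map (C : ℂ → MvPolynomial (Fin 1) ℂ) + (X 0 : MvPolynomial (Fin 1) ℂ) • w.map C) (m : ℕ) (i j : Fin b) :
    (M ^ (m + 1)) i j = ∑ l, C (A l j) * (M ^ m) i l + ∑ l, C (w l j) * (M ^ m) i l * X 0 := by
  rw [pow_succ, Matrix.mul_apply, ← Finset.sum_add_distrib]
  refine Finset.sum_congr rfl fun l _ => ?_
  have hMlj : M l j = C (A l j) + X 0 * C (w l j) := by
    rw [hM]; simp only [Matrix.add_apply, Matrix.map_apply, Matrix.smul_apply, smul_eq_mul]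
  rw [hMlj]
  ring

/-- The degree weight of the exponent `s^d`: `Σ_{i ∈ supp} (single 0 d) i = d`. -/
theorem sum_support_single_fin_one (d : ℕ) (hd : d ≠ 0) :
    ∑ i ∈ (Finsupp.single (0 : Fin 1) d).support, (Finsupp.single (0 : Fin 1) d) i = d := by
  rw [Finsupp.support_single _ hd, Finset.sum_singleton, Finsupp.single_eq_same]

/-- Coefficients above the degree vanish: `coeff (s^d) (M^m)_{ij} = 0` for `m < d`. -/
theorem coeff_lineMat_pow_eq_zero_of_lt (A w : Matrix (Fin b) (Fin b) ℂ) (M : Matrix (Fin b) (Fin b) (MvPolynomial (Fin 1) ℂ))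
    (hM : M = A.map (C : ℂ → MvPolynomial (Fin 1) ℂ) + (X 0 : MvPolynomial (Fin 1) ℂ) • w.map C) {m d : ℕ} (hd : m < d)
    (i j : Fin b) : coeff (Finsupp.single 0 d) ((M ^ m) i j) = 0 := by
  apply coeff_eq_zero_of_totalDegree_lt
  have hdeg := totalDegree_lineMat_pow_le A w m i j
  rw [← hM] at hdeg
  refine lt_of_le_of_lt hdeg ?_
  rw [sum_support_single_fin_one d (by omega)]
  exact hd

/-- The TOP coefficient: `coeff (s^m) (M^m) = w^m`. -/
theorem coeff_top_lineMat_pow (A w : Matrix (Fin b) (Fin b) ℂ) (M : Matrix (Fin b) (Fin b) (MvPolynomial (Fin 1) ℂ))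
    (hM : M = A.map (C : ℂ → MvPolynomial (Fin 1) ℂ) + (X 0 : MvPolynomial (Fin 1) ℂ) • w.map C) (m : ℕ) (i j : Fin b) :
    coeff (Finsupp.single 0 m) ((M ^ m) i j) = (w ^ m) i j := by
  induction m generalizing i j with
  | zero =>
    rw [pow_zero, pow_zero, Finsupp.single_zero, Matrix.one_apply, Matrix.one_apply]
    split_ifs
    · exact coeff_zero_one
    · exact coeff_zero _
  | succ m ih =>
    rw [lineMat_pow_succ_apply A w M hM, coeff_add, coeff_sum, coeff_sum, pow_succ, Matrix.mul_apply]
    have h1 : ∑ l, coeff (Finsupp.single 0 (m + 1)) (C (A l j) * (M ^ m) i l) = 0 := by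
      refine Finset.sum_eq_zero fun l _ => ?_
      rw [coeff_C_mul, coeff_lineMat_pow_eq_zero_of_lt A w M hM (Nat.lt_succ_self m), mul_zero]
    rw [h1, zero_add]
    refine Finset.sum_congr rfl fun l _ => ?_
    rw [Finsupp.single_add, coeff_mul_X, coeff_C_mul, ih, mul_comm]

/-- ★ The SECOND coefficient: `coeff (s^m) (M^{m+1}) = Σ_{l ≤ m} w^l A w^{m−l}` — the one-letter mixed word. -/
theorem coeff_second_lineMat_pow (A w : Matrix (Fin b) (Fin b) ℂ) (M : Matrix (Fin b) (Fin b) (MvPolynomial (Fin 1) ℂ))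
    (hM : M = A.map (C : ℂ → MvPolynomial (Fin 1) ℂ) + (X 0 : MvPolynomial (Fin 1) ℂ) • w.map C) (m : ℕ) (i j : Fin b) :
    coeff (Finsupp.single 0 m) ((M ^ (m + 1)) i j) = (∑ l ∈ Finset.range (m + 1), w ^ l * A * w ^ (m - l)) i j := by
  classical
  induction m generalizing i j with
  | zero =>
    rw [lineMat_pow_succ_apply A w M hM, coeff_add, coeff_sum, coeff_sum, pow_zero, Finset.sum_range_one, Nat.sub_zero, pow_zero,
      Matrix.one_mul, Matrix.mul_one]
    have h2 : ∑ l, coeff (Finsupp.single (0 : Fin 1) 0) (C (w l j) * (1 : Matrix (Fin b) (Fin b) (MvPolynomial (Fin 1) ℂ)) i l * X 0) =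
        0 := by
      refine Finset.sum_eq_zero fun l _ => ?_
      rw [Finsupp.single_zero, coeff_mul_X', if_neg (by simp)]
    rw [h2, add_zero, Finset.sum_eq_single i]
    · rw [Matrix.one_apply_eq, mul_one, Finsupp.single_zero, coeff_zero_C]
    · intro l _ hl
      rw [Matrix.one_apply_ne (Ne.symm hl), mul_zero, coeff_zero]
    · intro h; exact absurd (Finset.mem_univ i) h
  | succ m ih =>
    rw [lineMat_pow_succ_apply A w M hM, coeff_add, coeff_sum, coeff_sum]
    -- first sum: the top coefficient of `M^{m+1}` times `A`
    have h1 : ∑ l, coeff (Finsupp.single 0 (m + 1)) (C (A l j) * (M ^ (m + 1)) i l) = (w ^ (m + 1) * A) i j := by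
      rw [Matrix.mul_apply]
      refine Finset.sum_congr rfl fun l _ => ?_
      rw [coeff_C_mul, coeff_top_lineMat_pow A w M hM, mul_comm]
    -- second sum: the second coefficient of `M^{m+1}` (induction) times `w`
    have h2 : ∑ l, coeff (Finsupp.single 0 (m + 1)) (C (w l j) * (M ^ (m + 1)) i l * X 0) =
        ((∑ l ∈ Finset.range (m + 1), w ^ l * A * w ^ (m - l)) * w) i j := by
      rw [Matrix.mul_apply]
      refine Finset.sum_congr rfl fun l _ => ?_
      rw [Finsupp.single_add, coeff_mul_X, coeff_C_mul, ih, mul_comm]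
    have key : w ^ (m + 1) * A + (∑ l ∈ Finset.range (m + 1), w ^ l * A * w ^ (m - l)) * w =
        ∑ l ∈ Finset.range (m + 1 + 1), w ^ l * A * w ^ (m + 1 - l) := by
      rw [Finset.sum_range_succ (fun l => w ^ l * A * w ^ (m + 1 - l)) (m + 1), Nat.sub_self, pow_zero, Matrix.mul_one,
        add_comm (w ^ (m + 1) * A), Finset.sum_mul]
      congr 1
      refine Finset.sum_congr rfl fun l hl => ?_
      have hl' : l < m + 1 := Finset.mem_range.mp hl
      rw [Matrix.mul_assoc, ← pow_succ, show m + 1 - l = m - l + 1 by omega]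
    rw [h1, h2, ← Matrix.add_apply, key]

/-! ## §2 The deep-mode instrument -/

/-- ★★★ **ONE-LETTER MIXED WORDS VANISH ALONG A CERTIFICATE.**  If `(V, W)` has the window property at order `k` (window `n`), then for all
`A ∈ V`, `w ∈ W` and `m` with `k + 1 ≤ m`, `m + 1 ≤ n − 1`:  `Σ_{l ≤ m} w^l · A · w^{m−l} = 0`. -/
theorem oneLetterWord_eq_zero_of_window (V W : Submodule ℂ (Matrix (Fin b) (Fin b) ℂ)) {n k : ℕ}
    (hwin : ∀ A ∈ V, ∀ w ∈ W, ∀ p : ℕ, p ≤ n - 1 → ∀ i j : Fin b,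
      ((((A.map (C : ℂ → MvPolynomial (Fin 1) ℂ) + (X 0 : MvPolynomial (Fin 1) ℂ) • w.map C) ^ p :
        Matrix (Fin b) (Fin b) (MvPolynomial (Fin 1) ℂ)) i j).totalDegree ≤ k))
    {A w : Matrix (Fin b) (Fin b) ℂ} (hA : A ∈ V) (hw : w ∈ W) {m : ℕ} (hkm : k + 1 ≤ m) (hmn : m + 1 ≤ n - 1) :
    ∑ l ∈ Finset.range (m + 1), w ^ l * A * w ^ (m - l) = 0 := by
  ext i j
  rw [← coeff_second_lineMat_pow A w _ rfl m i j, Matrix.zero_apply]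
  apply coeff_eq_zero_of_totalDegree_lt
  refine lt_of_le_of_lt (hwin A hA w hw (m + 1) hmn i j) ?_
  rw [sum_support_single_fin_one m (by omega)]
  omega

end Summit.ValiantsHypothesis.ValiantsHypothesis.Theorems.GrenetZeon.LongMassHomogenise

end
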